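import Summits.ResolutionOfSingularities.ResolutionOfSingularities.Theorems.EquisingularLiftEquisingularLiftNatNoseTowerZeroRung
import Summits.ResolutionOfSingularities.ResolutionOfSingularities.Theorems.EquisingularLiftEquisingularLiftNatNoseDescEngine
import HarnessLib

/-!
# [OURS · L1 W4.5(b) · EL♮(3) · WIDTH TABLE D18 «DESCENT-CERTIFICATE DOOR», rung row] RUNG^{D18} ★★ `nose_desc_rung_three`
# `(T-k) → p.Prime → ∀ k … → NoseHypHostedNestEquinodalDirectCILiftTowerZeroPrimeSigmaPGBTriplePrimeDesc₂ k 3 H ι → ELNatConclusionO k 3 H ι` (binder = RUNG^{τ0′}'s VERBATIM)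

res-L1-w45b-nose-w1 g8 (WIDTH seat D-0157 DOOR 1; desk RULING R88 (2) 2026-08-29T14:09Z «RUNG `nose_desc_rung_three (p) : EmbeddedCurveLiftFact →
p.Prime → ∀ k [Field k] [CharP k p] [IsAlgClosed k] (H ι), IsClosedImmersion ι → IsIntegral H → (ker ι locally principal) →
NoseHypHostedNestEquinodalDirectCILiftTowerZeroPrimeSigmaPGBTriplePrimeDesc₂ k 3 H ι → ELNatConclusionO k 3 H ι` = `Or.elim` of ✓ `nose_tower_rung_three`
and `descDoor_elnat` (same binder order as ✓ p722655 :42)»).  Blob E10 = res-type-027's ✓ `…NatResidueHypDefsE10` (p724482): the TOP-LEVEL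
disjunction «✓ blob E9′ `NoseHypHostedNestEquinodalDirectCILiftTowerZeroPrimeSigmaPGBTriplePrime₂ k n H ι` ∨ `DescDoor k n H ι`» (res-L1-w45b-idea-2
D18-LETTERS v1.3 (L3)).  Arm 1 = ✓ RUNG^{τ0′} `nose_tower_rung_three` (…NatNoseTowerZeroRung, this seat g7, p722655) VERBATIM — it consumes (T-k);
arm 2 = ★★ `descDoor_elnat` (…NatNoseDescEngine, this seat g8) — FACT-FREE, any `n`, no hypothesis on `H` (the three hypotheses `hι hH hloc`
and (T-k) are NOT used on that arm).  OURS; NOT a statement of any manuscript ([Hironaka2017] is a candidate under adjudication, nothing of it is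
asserted); AI-written, weaker than expert review.  No `sorry`; standard axioms; DEF-FREE; the ONLY named hypothesis is (T-k) `EmbeddedCurveLiftFact`
(the registered `stub_elnat_embeddedCurveLiftFact`), needed by arm 1 only.  `--supports stmt-ResolutionOfSingularities-20148 --as helper`, counted 0.
EL♮(3) is NOT proved here: after the 53rd REPLACE the nose residue reads `¬ NoseHypHostedNestEquinodalDirectCILiftTowerZeroPrimeSigmaPGBTriplePrimeDesc₂`;
resolution of singularities in positive characteristic is NOT proved anywhere in this tree (dim 3 in print: Cossart–Piltant 2008/2009).
[folklore; pure composition of ✓ modules]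
-/

set_option linter.dupNamespace false -- mandated namespace `Summit.<Summit>.<Problem>` of this single-conjunct summit

noncomputable section

open CategoryTheory CategoryTheory.Limits AlgebraicGeometry TopologicalSpace Topology
open Summit.ResolutionOfSingularities.ResolutionOfSingularities.Theses.EquisingularLift.Split
open Summit.ResolutionOfSingularities.ResolutionOfSingularities.Cruxes.EquisingularLift.StrataSplit

namespace Summit.ResolutionOfSingularities.ResolutionOfSingularities.Cruxes.EquisingularLiftNat.Sections

/-- ★★ **THE RUNG (R-D18) `nose_desc_rung_three`: surfaces `H ⊂ ℙ³_k` satisfying blob E10 = «blob E9′ ∨ DescDoor» (res-type-027's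
✓ `NoseHypHostedNestEquinodalDirectCILiftTowerZeroPrimeSigmaPGBTriplePrimeDesc₂`, WIDTH TABLE D18 «DESCENT-CERTIFICATE DOOR», desk R88) satisfy
EL♮(3)'s conclusion, GIVEN (T-k).**  = ONE `Or` case split: the E9′ arm is ✓ `nose_tower_rung_three` verbatim (desk kit call shape
`nose_desc_rung_three p stub_elnat_embeddedCurveLiftFact hp k H ι hι hH hloc hDESC`), the D18 arm is ★★ `descDoor_elnat p hp k 3 H ι` (Fact-free).
[OURS · L1 W4.5b · rung of the 53rd REPLACE «¬blob_E9′ ↦ ¬blob_E10»; NOT a statement of the manuscript; EL♮(3) NOT proved] -/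
theorem nose_desc_rung_three (p : ℕ) : EmbeddedCurveLiftFact → p.Prime →
    ∀ (k : Type) [Field k] [CharP k p] [IsAlgClosed k] (H : AlgebraicGeometry.Scheme.{0})
    (ι : H ⟶ (Literature.AlgebraicGeometry.Motives.projectiveSpace 3 k).left),
    AlgebraicGeometry.IsClosedImmersion ι → AlgebraicGeometry.IsIntegral H →
    (∀ y : (Literature.AlgebraicGeometry.Motives.projectiveSpace 3 k).left,
      ∃ U : (Literature.AlgebraicGeometry.Motives.projectiveSpace 3 k).left.affineOpens,
        y ∈ (U : (Literature.AlgebraicGeometry.Motives.projectiveSpace 3 k).left.Opens) ∧ (ι.ker.ideal U).IsPrincipal) →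
    NoseHypHostedNestEquinodalDirectCILiftTowerZeroPrimeSigmaPGBTriplePrimeDesc₂ k 3 H ι → ELNatConclusionO k 3 H ι := by
  intro hF hp k _ _ _ H ι hι hH hloc hE
  rcases hE with h9 | hD
  · exact nose_tower_rung_three p hF hp k H ι hι hH hloc h9
  · exact descDoor_elnat p hp k 3 H ι hD

end Summit.ResolutionOfSingularities.ResolutionOfSingularities.Cruxes.EquisingularLiftNat.Sections

end
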